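import Summits.Ventures.LatticeQCDFlow.Scaling.AnyScheduleProtocolLawEnvelope
import Literature.Analysis.SpecialFunctions.GegenbauerHeatHarnack
import HarnessLib

/-!
PART 2 of 2 (§5 lattice, §6 Wilson).  CUSTODY: theory2 item 130 (GEN-44, HOME tier) re-landed by lean-2 per the lead's custody grant (packet member
after 125 → 126 → 127 → 128 → 129); statements and proofs = HOME/lean/theory2/AnyScheduleProtocolLaw.lean
333613e931952657 (666 l) verbatim, split below the `lint.size` line into TWO files
(`AnyScheduleProtocolLawEnvelope` §1–§4 abstract, `AnyScheduleProtocolLaw` §5–§6 lattice / Wilson, the second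
importing the first); headers trimmed (PART 2 keeps the full HOME header); imports = HOME's (all tree
modules: items 125 and 129 as landed); landing edits: six docstrings added where the lint asks and — named by
the gate's `near-duplicate` screen at the preflight dry-run — HOME's elementary `sq_div_add_mono` (≡ a lemma of
`Summits/QuantumFields/QCD/Theorems/…FreeMajorantToolkitAux.lean`) and the unused `sq_div_add_anti` DROPPED, the
single use of the former in `protocolCost_ge_sq_div_reach` inlined with its own three-line proof; no other
declaration changes (builder `build130.py` in the custodian's seat folder); PART 2 only (gate `dedup.landed` at its dry-run): HOME's
`convexOn_univ_of_hasDerivAt₂_nonneg` deleted in favour of the identical landed Literature lemma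
`Literature.Analysis.SpecialFunctions.convexOn_univ_of_hasDerivAt2_nonneg` (import added, one use re-pointed).

# THEORY-2 item 130 — the `log²` LAYER LAW and the WINDOW LAW hold for EVERY SCHEDULE, not only
monotone ones: backtracking, re-heating, cycling through the Haar measure (tempered transitions
`β → 0 → β`) never lower the exact-reweighting cost below that of the largest UPWARD excursion

HONEST FRAMING: exact (Metropolis-corrected) sampling algorithms for lattice gauge theory;
figures of merit are autocorrelation/cost numbers at stated couplings and volumes; no
continuum-physics claim.

OURS (pub-lqcd THEORY-2, gen-44; HOME tier, LEAD LINE 194 (B): it SHARPENS items 125 + 129 by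
removing their one structural hypothesis `Monotone b`; no new calculus, 0 kit).

WHAT ITEMS 125 / 129 LEFT OPEN.  Every layer / window law so far (`protocolCost_ge_sq_div`,
`layers_necessary`, `logRatio_le_of_stepCost` of item 125; the shifted / Haar-start forms of
item 129) is stated for MONOTONE protocols `b_0 ≤ b_1 ≤ … ≤ b_m`.  Practical exact schedules are
often not monotone: tempered transitions heat to the prior and cool back (`β → 0 → β`),
nonequilibrium candidate moves use symmetric `β → β' → β` protocols, adaptive SMC schedules
backtrack, replica ladders are traversed up and down.  Could a detour LOWER the product of the
per-step second moments `Π_j E_{μ_{b_j}}[w_j²]` needed to climb from `b_i` to `b_k`?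

THIS FILE: NO.  For a free energy `F` convex on `ℝ` (every cumulant generating function is):
* §1 (two lines of convexity).  The cost of one exact step `x → y`,
  `c(x, y) = F(x) + F(2y − x) − 2F(y)`, is `≥ 0` for EVERY step, upward or downward
  (`secondDiff_nonneg`), and for steps INTO a fixed target `y` from below it is monotone in the
  distance: `x ≤ x' ≤ y ⟹ c(x', y) ≤ c(x, y)` (`secondDiff_anti`).
* §2 (the monotone envelope).  The running maximum `M_j = max_{l ≤ j} b_l` of ANY protocol is a
  monotone protocol with the same start whose cost is termwise dominated:
  **`protocolCost F M ≤ protocolCost F b`** (`protocolCost_runMax_le`), and every step of `M`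
  costs at most the same step of `b` (`stepCost_runMax_le`) — a record step `b_{j+1} > M_j` of `b`
  enters the same target from farther below, every other step of `M` is null.
* §3 (windows).  The window `b_i, …, b_k` of a protocol is a protocol with `k − i` steps whose
  cost is at most the whole cost (`protocolCost_window_le`, by §1 every dropped step is `≥ 0`).
* §4 (the laws, abstract).  Hence item 125's three laws hold for EVERY protocol and every pair
  of indices `i < k` (`i ≤ k` for the window law) with `β₀ ≤ b_i ≤ b_k` — with
  `U = log(b_k/b_i)` and `m = k − i` steps in between (the whole-protocol forms with `n` in
  place of `k − i`: `protocolCost_ge_sq_div_reach`, `logRatio_le_of_stepCost_reach`, §2):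
  **`K·U²/(m + U) ≤ protocolCost F b`** (`protocolCost_ge_sq_div_window`),
  **`m ≥ K·U²/t − U`** if the total cost is `≤ t` (`steps_necessary_window`),
  **`U ≤ m·(t₀/K + √(t₀/K))`** if every step costs `≤ t₀` (`logRatio_le_of_stepCost_window`);
  and the shifted forms with `U = log((1+b_k)/(1+b_i))`, `0 ≤ b_i ≤ b_k`, under item 129's
  convexity of `v ↦ F(v − 1) + K log v` on `[1, ∞)` (`…_window_shift`).
* §5 (lattice, smooth action `S` on `SU(N)^E`).  `ψ_S = log Z` is convex on `ℝ`
  (`convexOn_univ_actionCGF`: `ψ_S″ = Var ≥ 0`, tree), so every exact reweighting step in the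
  coupling — in either direction — has `log E_{μ_β}[w²] ≥ 0` (`log_weightSqMoment_nonneg`), and
  under item 125's floor (SH) on `[β₀, ∞)`, resp. item 129's all-coupling floor (AF), the three
  laws hold for every schedule and every window (`protocolLaw_window_of_specificHeatFloor`,
  `steps_necessary_window_of_allCouplingFloor`, `logRatio_le_of_stepCost_window_of_…`, …).
* §6 (Wilson, `SU(n)`, `n ≥ 2`, `d ≥ 2`, UNCONDITIONAL, one `c = c(n,d) > 0` for all volumes
  `L ≥ 2`, item 129's `wilson_allCouplingFloor`).  For EVERY schedule `b_0, …, b_m` of exact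
  reweighting steps (any signs of the increments, any start) and every `i ≤ k` with
  `0 ≤ b_i ≤ b_k`:
  **`c·#plaq·log²((1+b_k)/(1+b_i))/((k−i) + log((1+b_k)/(1+b_i))) ≤ Σ_{j<m} log E_{μ_{b_j}}[w_j²]`**
  (`wilson_protocolLaw_anySchedule`); **`k − i ≥ c·#plaq·log²(…)/t − log(…)`** if the total is
  `≤ t` (`wilson_steps_necessary_anySchedule`); **`log((1+b_k)/(1+b_i)) ≤ (k−i)·(s + √s)`**,
  `s = t₀/(c·#plaq)`, if every step has `log E[w_j²] ≤ t₀`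
  (`wilson_logRatio_le_of_stepCost_anySchedule`).
  HAAR VISITS (`b_i = 0`, `b_k = β`): a schedule that is at the Haar measure at step `i` and at
  coupling `β` at step `k` has **`k − i ≥ c·#plaq·log²(1+β)/t − log(1+β)`**
  (`wilson_steps_necessary_haarVisit`) and **`log(1+β) ≤ (k−i)(s+√s)`**
  (`wilson_logRatio_le_of_stepCost_haarVisit`): the tempered-transition route `β → 0 → β` and
  every other excursion through strong coupling costs at least what plain annealing from the
  Haar prior costs (item 129), in every volume; the downward half contributes `≥ 0`, never `< 0`.

WHAT IT DOES NOT SAY.  As items 125/129: `c` is an existence constant; the quantity bounded is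
the perfect-relaxation cost `Σ_j log E_{μ_{b_j}}[w_j²]` of SEQUENTIAL EXACT REWEIGHTING in the
coupling (equivalently `−Σ_j log ESS_j`), not the autocorrelation time of a given Markov chain,
not a training cost, nothing about fermions, nothing specific at `β ≈ 6`.  A non-monotone
schedule may of course be CHEAPER PER UNIT OF SOMETHING ELSE (wall-clock mixing inside each
ensemble, round-trip rates): the theorem only says the reweighting budget across a coupling ratio
cannot be reduced by detours.  The laws are blind to the order in which a schedule visits
couplings below the running maximum.  With IMPERFECT relaxation between the steps the realised
ESS of an annealed sampler is another number (THEORY-2 v2.5 (C3′)/(C3″): non-monotone LAYERS can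
beat the perfect-relaxation value, monotone ones cannot); nothing here is claimed about it.

Dictionary (tree / HOME): `protocolCost`, `protocolCost_ge_sq_div`, `layers_necessary`,
`logRatio_le_of_stepCost`, `actionCGF`, `actionVar`, `weightSqMoment`, `log_weightSqMoment`,
`sum_log_weightSqMoment_eq_protocolCost`, `SpecificHeatFloor`, `convexOn_actionCGF_of_floor`
(item 125); `protocolCost_shift`, `convexOn_actionCGF_shift_of_allCouplingFloor`,
`wilson_allCouplingFloor`, `card_plaquette_pos` (item 129); `hasDerivAt_cgf_neg_action`,
`hasDerivAt_deriv_cgf`, `contDiff_ambWilsonAction` (T25 `ReweightingStepLaw` / Lüscher 2010 tree).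
The two `import Summits.Ventures.LatticeQCDFlow.Scaling.{SpecificHeatFloorLog2Law,
HaarStartProtocolLaw}` lines name item 125 (PART 2 of the custody packet, LEAD LINES 245/249) and
HOME item 129 at a would-be module name (item 129 is HOME tier; the name is a PLACEHOLDER): point
them at the modules under which those files actually land; nothing else here depends on it.
Certificate: `check/AnyScheduleProtocolLaw_concat.lean` = items 125 ‖ 126 ‖ 127 ‖ 128 ‖ 129 ‖ 130
(builder `check/concat_v57.py`), farm `lean check` rc 0 · 0 sorry · axioms standard.
-/

noncomputable section

open Finset Set Real

namespace Summit.Ventures.LatticeQCDFlow.Theory2.AnySchedule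

open Summit.Ventures.LatticeQCDFlow.Theory2.SpecificHeat
open Summit.Ventures.LatticeQCDFlow.Theory2.HaarStart

/-! ## §5. Lattice gauge theory: `ψ_S` is convex on `ℝ`; the laws for every schedule of exact
reweighting steps in the coupling -/

section LatticeGauge

open MeasureTheory ProbabilityTheory
open Literature.MathematicalPhysics.QuantumFieldTheory
open Literature.MathematicalPhysics.QuantumFieldTheory.Luscher2010
open Literature.MathematicalPhysics.QuantumFieldTheory.WilsonFlow (coeConfig)
open Summit.Ventures.LatticeQCDFlow.TrivializingMaps
open scoped ContDiff Matrix Matrix.Norms.Frobenius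

variable {d L N : ℕ} [NeZero L] {S : AmbConfig d L N → ℝ} {n : ℕ}

/-- **`ψ_S = log Z` is convex on all of `ℝ`** (`ψ_S″(t) = Var_t(S) ≥ 0`, tree
`hasDerivAt_deriv_cgf`). [folklore] -/
theorem convexOn_univ_actionCGF (hS : ContDiff ℝ ∞ S) : ConvexOn ℝ univ (actionCGF S) :=
  Literature.Analysis.SpecialFunctions.convexOn_univ_of_hasDerivAt2_nonneg (fun t => hasDerivAt_cgf_neg_action hS t)
    (fun t => hasDerivAt_deriv_cgf hS t) fun _ => variance_nonneg _ _

/-- **Every exact reweighting step in the coupling, upward or downward, has `E_{μ_β}[w²] ≥ 1`**: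
`0 ≤ log E_{μ_β}[w²]` for all real `β`, `δ`. [folklore] -/
theorem log_weightSqMoment_nonneg (hS : ContDiff ℝ ∞ S) (β δ : ℝ) :
    0 ≤ Real.log (weightSqMoment S β δ) := by
  rw [log_weightSqMoment hS]
  have h := secondDiff_nonneg (convexOn_univ_actionCGF hS) β (β + δ)
  rw [show 2 * (β + δ) - β = β + 2 * δ by ring] at h
  linarith

/-- **LATTICE `log²` LAW FOR EVERY SCHEDULE AND WINDOW under (SH).**  For a smooth action `S` on
`SU(N)^E` with the specific-heat floor (SH) on `[β₀, ∞)` (`K ≥ 0`), EVERY schedule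
`b_0, …, b_n` of exact reweighting steps and all `i < k` with `β₀ ≤ b_i ≤ b_k` obey
**`K·log²(b_k/b_i)/((k−i) + log(b_k/b_i)) ≤ Σ_j log E_{μ_{b_j}}[w_j²]`**. [ours] -/
theorem protocolLaw_window_of_specificHeatFloor (hS : ContDiff ℝ ∞ S) {β₀ K : ℝ} (hβ₀ : 0 < β₀)
    (hK : 0 ≤ K) (hSH : SpecificHeatFloor S β₀ K) (b : Fin (n + 1) → ℝ) {i k : Fin (n + 1)}
    (hik : i < k) (hi : β₀ ≤ b i) (hbk : b i ≤ b k) :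
    K * (Real.log (b k / b i)) ^ 2 / (((k : ℕ) - (i : ℕ) : ℝ) + Real.log (b k / b i)) ≤
      ∑ j : Fin n, Real.log (weightSqMoment S (b j.castSucc) (b j.succ - b j.castSucc)) := by
  rw [sum_log_weightSqMoment_eq_protocolCost hS]
  exact protocolCost_ge_sq_div_window hβ₀ hK (convexOn_univ_actionCGF hS)
    (convexOn_actionCGF_of_floor hS hβ₀ hSH) b hik hi hbk

/-- **LATTICE STEPS NECESSARY under (SH)**: `Σ_j log E[w_j²] ≤ t` forces
**`k − i ≥ K·log²(b_k/b_i)/t − log(b_k/b_i)`**. [ours] -/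
theorem steps_necessary_window_of_specificHeatFloor (hS : ContDiff ℝ ∞ S) {β₀ K t : ℝ}
    (hβ₀ : 0 < β₀) (hK : 0 ≤ K) (hSH : SpecificHeatFloor S β₀ K) (b : Fin (n + 1) → ℝ)
    {i k : Fin (n + 1)} (hik : i < k) (hi : β₀ ≤ b i) (hbk : b i ≤ b k) (ht : 0 < t)
    (hcost :
      ∑ j : Fin n, Real.log (weightSqMoment S (b j.castSucc) (b j.succ - b j.castSucc)) ≤ t) :
    K * (Real.log (b k / b i)) ^ 2 / t - Real.log (b k / b i) ≤ ((k : ℕ) - (i : ℕ) : ℝ) := by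
  rw [sum_log_weightSqMoment_eq_protocolCost hS] at hcost
  exact steps_necessary_window hβ₀ hK (convexOn_univ_actionCGF hS)
    (convexOn_actionCGF_of_floor hS hβ₀ hSH) b hik hi hbk ht hcost

/-- **LATTICE WINDOW LAW FOR EVERY SCHEDULE under (SH)**: if every step has `log E[w_j²] ≤ t₀`
then **`log(b_k/b_i) ≤ (k − i)·(t₀/K + √(t₀/K))`** (`K > 0`). [ours] -/
theorem logRatio_le_of_stepCost_window_of_specificHeatFloor (hS : ContDiff ℝ ∞ S)
    {β₀ K t₀ : ℝ} (hβ₀ : 0 < β₀) (hK : 0 < K) (hSH : SpecificHeatFloor S β₀ K)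
    (b : Fin (n + 1) → ℝ) {i k : Fin (n + 1)} (hik : i ≤ k) (hi : β₀ ≤ b i) (hbk : b i ≤ b k)
    (ht : 0 ≤ t₀)
    (hstep : ∀ j : Fin n,
      Real.log (weightSqMoment S (b j.castSucc) (b j.succ - b j.castSucc)) ≤ t₀) :
    Real.log (b k / b i) ≤ ((k : ℕ) - (i : ℕ) : ℝ) * (t₀ / K + Real.sqrt (t₀ / K)) := by
  refine logRatio_le_of_stepCost_window hβ₀ hK (convexOn_univ_actionCGF hS)
    (convexOn_actionCGF_of_floor hS hβ₀ hSH) b hik hi hbk ht fun j => ?_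
  have h := hstep j
  rw [log_weightSqMoment hS, add_sub_cancel, show b j.castSucc + 2 * (b j.succ - b j.castSucc) =
    2 * b j.succ - b j.castSucc by ring] at h
  exact h

/-- **LATTICE `log²` LAW FOR EVERY SCHEDULE AND WINDOW under the ALL-COUPLING FLOOR**
`∀ u ≥ 0, K/(1+u²) ≤ Var_u(S)` (`K ≥ 0`): for all `i < k` with `0 ≤ b_i ≤ b_k`,
**`K·log²((1+b_k)/(1+b_i))/((k−i) + log((1+b_k)/(1+b_i))) ≤ Σ_j log E_{μ_{b_j}}[w_j²]`**.
[ours] -/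
theorem protocolLaw_window_of_allCouplingFloor (hS : ContDiff ℝ ∞ S) {K : ℝ} (hK : 0 ≤ K)
    (hAF : ∀ u : ℝ, 0 ≤ u → K / (1 + u ^ 2) ≤ actionVar S u) (b : Fin (n + 1) → ℝ)
    {i k : Fin (n + 1)} (hik : i < k) (hi : 0 ≤ b i) (hbk : b i ≤ b k) :
    K * (Real.log ((1 + b k) / (1 + b i))) ^ 2 /
        (((k : ℕ) - (i : ℕ) : ℝ) + Real.log ((1 + b k) / (1 + b i))) ≤
      ∑ j : Fin n, Real.log (weightSqMoment S (b j.castSucc) (b j.succ - b j.castSucc)) := by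
  rw [sum_log_weightSqMoment_eq_protocolCost hS]
  exact protocolCost_ge_sq_div_window_shift hK (convexOn_univ_actionCGF hS)
    (convexOn_actionCGF_shift_of_allCouplingFloor hS hK hAF) b hik hi hbk

/-- **LATTICE STEPS NECESSARY under (AF)**: `Σ_j log E[w_j²] ≤ t` forces
**`k − i ≥ K·log²((1+b_k)/(1+b_i))/t − log((1+b_k)/(1+b_i))`**. [ours] -/
theorem steps_necessary_window_of_allCouplingFloor (hS : ContDiff ℝ ∞ S) {K t : ℝ} (hK : 0 ≤ K)
    (hAF : ∀ u : ℝ, 0 ≤ u → K / (1 + u ^ 2) ≤ actionVar S u) (b : Fin (n + 1) → ℝ)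
    {i k : Fin (n + 1)} (hik : i < k) (hi : 0 ≤ b i) (hbk : b i ≤ b k) (ht : 0 < t)
    (hcost :
      ∑ j : Fin n, Real.log (weightSqMoment S (b j.castSucc) (b j.succ - b j.castSucc)) ≤ t) :
    K * (Real.log ((1 + b k) / (1 + b i))) ^ 2 / t - Real.log ((1 + b k) / (1 + b i)) ≤
      ((k : ℕ) - (i : ℕ) : ℝ) := by
  rw [sum_log_weightSqMoment_eq_protocolCost hS] at hcost
  exact steps_necessary_window_shift hK (convexOn_univ_actionCGF hS)
    (convexOn_actionCGF_shift_of_allCouplingFloor hS hK hAF) b hik hi hbk ht hcost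

/-- **LATTICE WINDOW LAW FOR EVERY SCHEDULE under (AF)**: every step `log E[w_j²] ≤ t₀` forces
**`log((1+b_k)/(1+b_i)) ≤ (k − i)·(t₀/K + √(t₀/K))`** (`K > 0`). [ours] -/
theorem logRatio_le_of_stepCost_window_of_allCouplingFloor (hS : ContDiff ℝ ∞ S) {K t₀ : ℝ}
    (hK : 0 < K) (hAF : ∀ u : ℝ, 0 ≤ u → K / (1 + u ^ 2) ≤ actionVar S u)
    (b : Fin (n + 1) → ℝ) {i k : Fin (n + 1)} (hik : i ≤ k) (hi : 0 ≤ b i) (hbk : b i ≤ b k)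
    (ht : 0 ≤ t₀)
    (hstep : ∀ j : Fin n,
      Real.log (weightSqMoment S (b j.castSucc) (b j.succ - b j.castSucc)) ≤ t₀) :
    Real.log ((1 + b k) / (1 + b i)) ≤ ((k : ℕ) - (i : ℕ) : ℝ) * (t₀ / K + Real.sqrt (t₀ / K)) := by
  refine logRatio_le_of_stepCost_window_shift hK (convexOn_univ_actionCGF hS)
    (convexOn_actionCGF_shift_of_allCouplingFloor hS hK.le hAF) b hik hi hbk ht fun j => ?_
  have h := hstep j
  rw [log_weightSqMoment hS, add_sub_cancel, show b j.castSucc + 2 * (b j.succ - b j.castSucc) =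
    2 * b j.succ - b j.castSucc by ring] at h
  exact h

end LatticeGauge

/-! ## §6. The Wilson action: the laws for EVERY schedule, unconditional, one constant for all
volumes; Haar visits -/

section Wilson

open MeasureTheory ProbabilityTheory
open Literature.MathematicalPhysics.QuantumFieldTheory
open Literature.MathematicalPhysics.QuantumFieldTheory.Luscher2010
open Literature.MathematicalPhysics.QuantumFieldTheory.WilsonFlow (coeConfig)
open Summit.Ventures.LatticeQCDFlow.TrivializingMaps
open scoped ContDiff Matrix Matrix.Norms.Frobenius

variable {d n : ℕ}

/-- **WILSON `log²` LAW FOR EVERY SCHEDULE, UNCONDITIONAL.**  For `n ≥ 2`, `d ≥ 2` there is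
`c = c(d, n) > 0` such that in EVERY volume `L ≥ 2`, EVERY schedule `b_0, …, b_m` of exact
reweighting steps for the `SU(n)` Wilson action (increments of any sign, any start) and all
indices `i < k` with `0 ≤ b_i ≤ b_k` obey
**`c·#plaq·log²((1+b_k)/(1+b_i))/((k−i) + log((1+b_k)/(1+b_i))) ≤ Σ_{j<m} log E_{μ_{b_j}}[w_j²]`**.
[ours] -/
theorem wilson_protocolLaw_anySchedule (hn : 2 ≤ n) (hd : 2 ≤ d) :
    ∃ c : ℝ, 0 < c ∧ ∀ (L : ℕ) [NeZero L], 2 ≤ L → ∀ (m : ℕ) (b : Fin (m + 1) → ℝ)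
      (i k : Fin (m + 1)), i < k → 0 ≤ b i → b i ≤ b k →
        c * Fintype.card (Plaquette d L) * (Real.log ((1 + b k) / (1 + b i))) ^ 2 /
            (((k : ℕ) - (i : ℕ) : ℝ) + Real.log ((1 + b k) / (1 + b i))) ≤
          ∑ j : Fin m, Real.log (weightSqMoment (ambWilsonAction : AmbConfig d L n → ℝ)
            (b j.castSucc) (b j.succ - b j.castSucc)) := by
  obtain ⟨c, hc, h⟩ := wilson_allCouplingFloor hn hd
  exact ⟨c, hc, fun L _ hL m b i k hik hi hbk =>
    protocolLaw_window_of_allCouplingFloor contDiff_ambWilsonAction (by positivity) (h L hL) b hik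
      hi hbk⟩

/-- **WILSON STEPS NECESSARY BETWEEN TWO COUPLINGS OF ANY SCHEDULE, UNCONDITIONAL**: with the same
`c`, in every volume `L ≥ 2`, if `Σ_j log E[w_j²] ≤ t` then for all `i < k` with
`0 ≤ b_i ≤ b_k`: **`k − i ≥ c·#plaq·log²((1+b_k)/(1+b_i))/t − log((1+b_k)/(1+b_i))`**. [ours] -/
theorem wilson_steps_necessary_anySchedule (hn : 2 ≤ n) (hd : 2 ≤ d) :
    ∃ c : ℝ, 0 < c ∧ ∀ (L : ℕ) [NeZero L], 2 ≤ L → ∀ (m : ℕ) (b : Fin (m + 1) → ℝ)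
      (i k : Fin (m + 1)), i < k → 0 ≤ b i → b i ≤ b k → ∀ t : ℝ, 0 < t →
        (∑ j : Fin m, Real.log (weightSqMoment (ambWilsonAction : AmbConfig d L n → ℝ)
            (b j.castSucc) (b j.succ - b j.castSucc))) ≤ t →
          c * Fintype.card (Plaquette d L) * (Real.log ((1 + b k) / (1 + b i))) ^ 2 / t -
              Real.log ((1 + b k) / (1 + b i)) ≤ ((k : ℕ) - (i : ℕ) : ℝ) := by
  obtain ⟨c, hc, h⟩ := wilson_allCouplingFloor hn hd
  exact ⟨c, hc, fun L _ hL m b i k hik hi hbk t ht hcost =>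
    steps_necessary_window_of_allCouplingFloor contDiff_ambWilsonAction (by positivity) (h L hL) b
      hik hi hbk ht hcost⟩

/-- **WILSON WINDOW LAW FOR EVERY SCHEDULE, UNCONDITIONAL**: with the same `c`, if every exact
reweighting step has `log E[w_j²] ≤ t₀` (`t₀ ≥ 0`) then for all `i ≤ k` with `0 ≤ b_i ≤ b_k`:
**`log((1+b_k)/(1+b_i)) ≤ (k − i)·(s + √s)`**, `s = t₀/(c·#plaq)` — any `k − i` consecutive
`O(1)`-window steps climb at most `(k−i)(s+√s)` in `log(1+β)`, in EVERY volume. [ours] -/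
theorem wilson_logRatio_le_of_stepCost_anySchedule (hn : 2 ≤ n) (hd : 2 ≤ d) :
    ∃ c : ℝ, 0 < c ∧ ∀ (L : ℕ) [NeZero L], 2 ≤ L → ∀ (m : ℕ) (b : Fin (m + 1) → ℝ)
      (i k : Fin (m + 1)), i ≤ k → 0 ≤ b i → b i ≤ b k → ∀ t₀ : ℝ, 0 ≤ t₀ →
        (∀ j : Fin m, Real.log (weightSqMoment (ambWilsonAction : AmbConfig d L n → ℝ)
            (b j.castSucc) (b j.succ - b j.castSucc)) ≤ t₀) →
          Real.log ((1 + b k) / (1 + b i)) ≤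
            ((k : ℕ) - (i : ℕ) : ℝ) * (t₀ / (c * Fintype.card (Plaquette d L)) +
              Real.sqrt (t₀ / (c * Fintype.card (Plaquette d L)))) := by
  obtain ⟨c, hc, h⟩ := wilson_allCouplingFloor hn hd
  refine ⟨c, hc, fun L _ hL m b i k hik hi hbk t₀ ht hstep => ?_⟩
  have hK : 0 < c * Fintype.card (Plaquette d L) := by
    have := card_plaquette_pos hd L
    positivity
  exact logRatio_le_of_stepCost_window_of_allCouplingFloor contDiff_ambWilsonAction hK (h L hL) b
    hik hi hbk ht hstep

/-- **HAAR VISITS — STEPS NECESSARY**: with the same `c`, in every volume `L ≥ 2`, a schedule of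
exact reweighting steps that is AT THE HAAR MEASURE at step `i` (`b_i = 0`) and at coupling
`β = b_k ≥ 0` at a later step `k`, with `Σ_j log E[w_j²] ≤ t`, has
**`k − i ≥ c·#plaq·log²(1+β)/t − log(1+β)`** steps in between — tempered transitions
`β → 0 → β`, restarts from the prior and cycling schedules included. [ours] -/
theorem wilson_steps_necessary_haarVisit (hn : 2 ≤ n) (hd : 2 ≤ d) :
    ∃ c : ℝ, 0 < c ∧ ∀ (L : ℕ) [NeZero L], 2 ≤ L → ∀ (m : ℕ) (b : Fin (m + 1) → ℝ)
      (i k : Fin (m + 1)), i < k → b i = 0 → 0 ≤ b k → ∀ t : ℝ, 0 < t →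
        (∑ j : Fin m, Real.log (weightSqMoment (ambWilsonAction : AmbConfig d L n → ℝ)
            (b j.castSucc) (b j.succ - b j.castSucc))) ≤ t →
          c * Fintype.card (Plaquette d L) * (Real.log (1 + b k)) ^ 2 / t -
              Real.log (1 + b k) ≤ ((k : ℕ) - (i : ℕ) : ℝ) := by
  obtain ⟨c, hc, h⟩ := wilson_steps_necessary_anySchedule (d := d) hn hd
  refine ⟨c, hc, fun L _ hL m b i k hik hi hk t ht hcost => ?_⟩
  have h' := h L hL m b i k hik hi.ge (by rw [hi]; exact hk) t ht hcost
  rwa [hi, add_zero, div_one] at h'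

/-- **HAAR VISITS — WINDOW LAW**: with the same `c`, if every step of the schedule has
`log E[w_j²] ≤ t₀` then between a visit of the Haar measure (`b_i = 0`) and a later visit of
coupling `β = b_k` there are `k − i ≥ log(1+β)/(s + √s)` steps, `s = t₀/(c·#plaq)`:
**`log(1+β) ≤ (k−i)(s+√s)`** — the `√VOLUME·log(1+β)` step count of item 129 for every schedule
through the prior, not only monotone annealing. [ours] -/
theorem wilson_logRatio_le_of_stepCost_haarVisit (hn : 2 ≤ n) (hd : 2 ≤ d) :
    ∃ c : ℝ, 0 < c ∧ ∀ (L : ℕ) [NeZero L], 2 ≤ L → ∀ (m : ℕ) (b : Fin (m + 1) → ℝ)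
      (i k : Fin (m + 1)), i ≤ k → b i = 0 → 0 ≤ b k → ∀ t₀ : ℝ, 0 ≤ t₀ →
        (∀ j : Fin m, Real.log (weightSqMoment (ambWilsonAction : AmbConfig d L n → ℝ)
            (b j.castSucc) (b j.succ - b j.castSucc)) ≤ t₀) →
          Real.log (1 + b k) ≤
            ((k : ℕ) - (i : ℕ) : ℝ) * (t₀ / (c * Fintype.card (Plaquette d L)) +
              Real.sqrt (t₀ / (c * Fintype.card (Plaquette d L)))) := by
  obtain ⟨c, hc, h⟩ := wilson_logRatio_le_of_stepCost_anySchedule (d := d) hn hd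
  refine ⟨c, hc, fun L _ hL m b i k hik hi hk t₀ ht hstep => ?_⟩
  have h' := h L hL m b i k hik hi.ge (by rw [hi]; exact hk) t₀ ht hstep
  rwa [hi, add_zero, div_one] at h'

/-- **Every Wilson reweighting step costs `≥ 0`** (both directions, every volume, every `n`, `d`):
the downward half of a detour can never pay for the upward half. [folklore] -/
theorem wilson_log_weightSqMoment_nonneg (L : ℕ) [NeZero L] (β δ : ℝ) :
    0 ≤ Real.log (weightSqMoment (ambWilsonAction : AmbConfig d L n → ℝ) β δ) :=
  log_weightSqMoment_nonneg contDiff_ambWilsonAction β δ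

end Wilson

end Summit.Ventures.LatticeQCDFlow.Theory2.AnySchedule

end
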